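import Summits.CriticalPhenomena.PercolationContinuityZ3.Theorems.PercNearOneGluingNoHeavyLowerTailSahiBlobReduction
import Summits.CriticalPhenomena.PercolationContinuityZ3.Theorems.PercNearOneGluingNoHeavyLowerTailIncStarRootPairWalks
import Summits.CriticalPhenomena.PercolationContinuityZ3.Theorems.PercNearOneGluingNoHeavyLowerTailIncStarApexForestSchema
import Summits.CriticalPhenomena.PercolationContinuityZ3.Theorems.PercNearOneGluingNoHeavyLowerTailCILScaledReferenceTools
import Summits.CriticalPhenomena.PercolationContinuityZ3.Theorems.PercNearOneGluingAdditiveGluingTieLiftOne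
import HarnessLib

/-!
# Root-pair concavity on apex-forests, I: transfer lemmas (reparametrisation, far trees, targets at the root)

Support file for the Sahi programme (`--supports stmt-CriticalPhenomena-4575`, prover prim-sahi-p2 gen 20).  No definitions, no named
facts, no sorries; standard axioms.  Memo `run/shared/lean/prim/prim-sahi/prim-sahi-p2/PROOF-E3.md` §30 (FC, cases (c-ii) and (d) of lead
g120 §8 / p2 (29d), (29p)).

**Setting.**  Product Bernoulli bond percolation `prodBernoulli w` on the pairs of `Fin n`, root `s`, targets `a, b, c`, the increasing star
`E₃ = sahiE3 P_w {s↔a} {s↔b} {s↔c}`, and a ROOT PAIR `e = s(s, x)`.  Along `e` the functional `q ↦ E₃(w[e↦q])` is a cubic; its concavity on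
`[0,1]` is expressed by the THREE-POINT inequality `(p₁ − p)·E₃(w[e↦p₀]) + (p − p₀)·E₃(w[e↦p₁]) ≤ (p₁ − p₀)·E₃(w[e↦p])` for
`0 ≤ p₀ ≤ p ≤ p₁ ≤ 1`.  This file supplies the three ingredients of the reduction steps in the proof that `E₃` is concave along EVERY root
pair of an apex-forest (`…IncStarRootPairConcaveForest`):

* `threePoint_transfer_real` — the three-point inequality passes through an affine non-decreasing reparametrisation `q ↦ θ + q·k`
  (pure real arithmetic);
* `incStar_rootSlot_threePoint` — a target AT the root: `E₃({s↔s}, B, C) = Cov(B, C)` is concave along every pair (one-bond decomposition,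
  `Cov″ = −2δ_Bδ_C ≤ 0` by monotonicity);
* `incStar_rootPair_eq_of_far` — a root pair into a tree of the environment holding no target does not change `E₃` (cut vertex `s`:
  `…IncStarCutVertex`, and locality of the far events);
* `incStar_rootPair_blob_transfer` — **blob reparametrisation**: if `x` lies in a blob interior `B ∌ s, y, a, b, c` whose only exits are `s` and
  `y`, then `E₃(w[s(s,x)↦q]) = E₃(W[s(s,y)↦r(q)])` with `W = w` switched off on the pairs meeting `B` and `r(q) = (1−q)θ₀ + qθ₁`, `θ₀ ≤ θ₁`
  (the blob's two-terminal probability, affine and non-decreasing in `q`; `SahiBlobReduction.sahiE3_incStar_blobReduce` + one-bond).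
-/

noncomputable section

namespace Summit.CriticalPhenomena.PercolationContinuityZ3.Theorems

namespace IncStar

open MeasureTheory Set Literature.Probability.Percolation Literature.Probability.LatticeModels
open Literature.Probability.Percolation.BlockExploration (mem_openConn_iff_openConnIn_univ)
open scoped Classical

variable {n : ℕ}

/-! ### Pure real arithmetic -/

/-- **Transfer of the three-point inequality along an affine non-decreasing reparametrisation.**  If `F₀, F, F₁` are the values of a
function at `θ + p₀k, θ + pk, θ + p₁k` (`k ≥ 0`) and the three-point inequality holds with those abscissae (hypothesis `hIH`), then it
holds with the weights `p₁ − p`, `p − p₀`, `p₁ − p₀` — for `k = 0` because the three values coincide (`hconst`). [this work] -/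
theorem threePoint_transfer_real {k θ p₀ p p₁ F₀ F F₁ : ℝ} (hk : 0 ≤ k)
    (hIH : ((θ + p₁ * k) - (θ + p * k)) * F₀ + ((θ + p * k) - (θ + p₀ * k)) * F₁ ≤ ((θ + p₁ * k) - (θ + p₀ * k)) * F)
    (hconst : k = 0 → F₀ = F ∧ F₁ = F) :
    (p₁ - p) * F₀ + (p - p₀) * F₁ ≤ (p₁ - p₀) * F := by
  by_cases hk0 : k = 0
  · obtain ⟨h0, h1⟩ := hconst hk0
    rw [h0, h1]
    have hid : (p₁ - p) * F + (p - p₀) * F = (p₁ - p₀) * F := by ring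
    rw [hid]
  · have hkpos : 0 < k := lt_of_le_of_ne hk (Ne.symm hk0)
    have hid : ((θ + p₁ * k) - (θ + p * k)) * F₀ + ((θ + p * k) - (θ + p₀ * k)) * F₁
        = k * ((p₁ - p) * F₀ + (p - p₀) * F₁) := by ring
    have hid' : ((θ + p₁ * k) - (θ + p₀ * k)) * F = k * ((p₁ - p₀) * F) := by ring
    rw [hid, hid'] at hIH
    exact le_of_mul_le_mul_left hIH hkpos

/-- **Three-point inequality for `L − B·C` with `L, B, C` affine and `B, C` non-decreasing** (`−(L − BC)″/2 = δ_Bδ_C ≥ 0`). [this work] -/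
theorem cov_threePoint_real (p₀ p p₁ b₀ b₁ c₀ c₁ l₀ l₁ : ℝ) (h01 : p₀ ≤ p) (h12 : p ≤ p₁) (hb : b₀ ≤ b₁) (hc : c₀ ≤ c₁) :
    (p₁ - p) * (((1 - p₀) * l₀ + p₀ * l₁) - ((1 - p₀) * b₀ + p₀ * b₁) * ((1 - p₀) * c₀ + p₀ * c₁))
      + (p - p₀) * (((1 - p₁) * l₀ + p₁ * l₁) - ((1 - p₁) * b₀ + p₁ * b₁) * ((1 - p₁) * c₀ + p₁ * c₁))
    ≤ (p₁ - p₀) * (((1 - p) * l₀ + p * l₁) - ((1 - p) * b₀ + p * b₁) * ((1 - p) * c₀ + p * c₁)) := by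
  have key : (p₁ - p₀) * (((1 - p) * l₀ + p * l₁) - ((1 - p) * b₀ + p * b₁) * ((1 - p) * c₀ + p * c₁))
      - ((p₁ - p) * (((1 - p₀) * l₀ + p₀ * l₁) - ((1 - p₀) * b₀ + p₀ * b₁) * ((1 - p₀) * c₀ + p₀ * c₁))
        + (p - p₀) * (((1 - p₁) * l₀ + p₁ * l₁) - ((1 - p₁) * b₀ + p₁ * b₁) * ((1 - p₁) * c₀ + p₁ * c₁)))
      = (p - p₀) * (p₁ - p) * (p₁ - p₀) * ((b₁ - b₀) * (c₁ - c₀)) := by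
    ring
  have hnn : 0 ≤ (p - p₀) * (p₁ - p) * (p₁ - p₀) * ((b₁ - b₀) * (c₁ - c₀)) :=
    mul_nonneg (mul_nonneg (mul_nonneg (sub_nonneg.2 h01) (sub_nonneg.2 h12)) (by linarith [h01, h12]))
      (mul_nonneg (sub_nonneg.2 hb) (sub_nonneg.2 hc))
  linarith

/-! ### A target at the root -/

/-- `E₃({s↔s}, B, C) = P(B ∩ C) − P(B)P(C)` (the first event is sure). [folklore] -/
theorem sahiE3_rootSlot_eq (μ : Measure (BondConfig (Fin n))) [IsProbabilityMeasure μ] (s : Fin n)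
    (B C : Set (BondConfig (Fin n))) :
    sahiE3 μ (openConn s s) B C = μ.real (B ∩ C) - μ.real B * μ.real C := by
  have huniv : (openConn s s : Set (BondConfig (Fin n))) = Set.univ :=
    Set.eq_univ_of_forall fun _ => SimpleGraph.Reachable.refl s
  rw [sahiE3_def, huniv]
  simp only [Set.univ_inter, probReal_univ]
  ring

/-- **A target at the root: `E₃({s↔s},{s↔b},{s↔c}) = Cov({s↔b},{s↔c})` is concave along every pair** (three-point form). [this work] -/
theorem incStar_rootSlot_threePoint (w : Sym2 (Fin n) → unitInterval) (e : Sym2 (Fin n)) (s b c : Fin n)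
    (p₀ p p₁ : unitInterval) (h01 : p₀ ≤ p) (h12 : p ≤ p₁) :
    ((p₁ : ℝ) - (p : ℝ)) * sahiE3 (prodBernoulli (Function.update w e p₀)) (openConn s s) (openConn s b) (openConn s c)
      + ((p : ℝ) - (p₀ : ℝ)) * sahiE3 (prodBernoulli (Function.update w e p₁)) (openConn s s) (openConn s b) (openConn s c)
    ≤ ((p₁ : ℝ) - (p₀ : ℝ)) * sahiE3 (prodBernoulli (Function.update w e p)) (openConn s s) (openConn s b) (openConn s c) := by
  have hb := tieLiftOne_real_zero_le_one w e (isUpperSet_openConn s b)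
  have hc := tieLiftOne_real_zero_le_one w e (isUpperSet_openConn s c)
  have h01' : (p₀ : ℝ) ≤ p := h01
  have h12' : (p : ℝ) ≤ p₁ := h12
  rw [sahiE3_rootSlot_eq, sahiE3_rootSlot_eq, sahiE3_rootSlot_eq,
    HullPort.real_update_affine w e p₀ (openConn s b ∩ openConn s c), HullPort.real_update_affine w e p₀ (openConn s b),
    HullPort.real_update_affine w e p₀ (openConn s c),
    HullPort.real_update_affine w e p (openConn s b ∩ openConn s c), HullPort.real_update_affine w e p (openConn s b),
    HullPort.real_update_affine w e p (openConn s c),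
    HullPort.real_update_affine w e p₁ (openConn s b ∩ openConn s c), HullPort.real_update_affine w e p₁ (openConn s b),
    HullPort.real_update_affine w e p₁ (openConn s c)]
  exact cov_threePoint_real _ _ _ _ _ _ _ _ _ h01' h12' hb hc

/-! ### A root pair into a target-free tree -/

/-- **Root pairs into a target-free tree of the environment do not matter.**  If none of the targets `a, b, c` is reachable from
`x ≠ s` in the environment `H(w)` (non-root pairs of positive weight), then `E₃(w[s(s,x)↦q]) = E₃(w)` for every `q`.  Proof: almost surely
the root is a cut vertex between the tree of `x` and the rest, so `{s↔t}` coincides with `{s↔t inside the far side}` for far `t`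
(`IncStarCutVertex.openConnIn_union_iff_of_mem_right`), an event determined by pairs not involving `s(s,x)`. [this work] -/
theorem incStar_rootPair_eq_of_far (w : Sym2 (Fin n) → unitInterval) {s x a b c : Fin n} (hxs : x ≠ s)
    (ha : ¬ (SimpleGraph.fromEdgeSet {z : Sym2 (Fin n) | s ∉ z ∧ w z ≠ 0}).Reachable x a)
    (hb : ¬ (SimpleGraph.fromEdgeSet {z : Sym2 (Fin n) | s ∉ z ∧ w z ≠ 0}).Reachable x b)
    (hc : ¬ (SimpleGraph.fromEdgeSet {z : Sym2 (Fin n) | s ∉ z ∧ w z ≠ 0}).Reachable x c) (q : unitInterval) :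
    sahiE3 (prodBernoulli (Function.update w s(s, x) q)) (openConn s a) (openConn s b) (openConn s c)
      = sahiE3 (prodBernoulli w) (openConn s a) (openConn s b) (openConn s c) := by
  set H := SimpleGraph.fromEdgeSet {z : Sym2 (Fin n) | s ∉ z ∧ w z ≠ 0} with hH
  set e : Sym2 (Fin n) := s(s, x) with he
  -- the root is isolated in the environment
  have hHs : ∀ {t : Fin n}, t ≠ s → ¬ H.Reachable t s := by
    intro t hts h
    exact apexForest_root_not_mem w hts (∅ : Set (Sym2 (Fin n))) (by rwa [SimpleGraph.deleteEdges_empty])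
  -- the two sides of the cut vertex `s`
  set V₁ : Set (Fin n) := {y | H.Reachable x y ∨ y = s} with hV₁
  set V₂ : Set (Fin n) := {y | ¬ H.Reachable x y} with hV₂
  have hV : ∀ y : Fin n, y ∈ V₁ → y ∈ V₂ → y = s := by
    rintro y (hy | hy) hy2
    · exact absurd hy hy2
    · exact hy
  have hs1 : s ∈ V₁ := Or.inr rfl
  have hs2 : s ∈ V₂ := fun h => hHs hxs h
  have hx2 : x ∉ V₂ := fun h => h (SimpleGraph.Reachable.refl x)
  have hunion : V₁ ∪ V₂ = Set.univ := by
    ext y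
    simp only [Set.mem_union, Set.mem_univ, iff_true]
    by_cases hy : H.Reachable x y
    · exact Or.inl (Or.inl hy)
    · exact Or.inr hy
  -- cross pairs have weight zero and are not `e`
  have hcross : ∀ y z : Fin n, y ∈ V₁ → z ∈ V₂ → y ≠ s → z ≠ s → w s(y, z) = 0 := by
    intro y z hy hz hys hzs
    have hy' : H.Reachable x y := hy.resolve_right hys
    by_contra hw
    have hyz : y ≠ z := fun h => hz (h ▸ hy')
    apply hz
    refine hy'.trans (SimpleGraph.Adj.reachable ?_)
    rw [hH, SimpleGraph.fromEdgeSet_adj]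
    refine ⟨⟨fun hmem => ?_, hw⟩, hyz⟩
    rcases Sym2.mem_iff.1 hmem with h | h
    · exact hys h.symm
    · exact hzs h.symm
  have hcross_ne : ∀ y z : Fin n, y ≠ s → z ≠ s → s(y, z) ≠ e := by
    intro y z hys hzs h
    have hmem : s ∈ s(y, z) := by rw [h, he]; exact Sym2.mem_mk_left s x
    rcases Sym2.mem_iff.1 hmem with h' | h'
    · exact hys h'.symm
    · exact hzs h'.symm
  -- almost surely, far root connections live on the far side
  have far_iff : ∀ (q' : unitInterval), ∀ ω ∈ {ω : BondConfig (Fin n) | ∀ z, Function.update w e q' z = 0 → z ∉ ω},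
      ∀ {t : Fin n}, t ∈ V₂ → (ω ∈ openConn s t ↔ ω ∈ openConnIn V₂ s t) := by
    intro q' ω hω t ht
    have hωcross : ∀ y z : Fin n, y ∈ V₁ → z ∈ V₂ → y ≠ s → z ≠ s → s(y, z) ∉ ω := by
      intro y z hy hz hys hzs
      refine hω _ ?_
      rw [Function.update_of_ne (hcross_ne y z hys hzs)]
      exact hcross y z hy hz hys hzs
    have key := IncStarCutVertex.openConnIn_union_iff_of_mem_right hV hs1 hs2 hωcross hs1 ht
    rw [hunion] at key
    rw [mem_openConn_iff_openConnIn_univ, key]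
    constructor
    · exact fun h => h.2
    · exact fun h => ⟨⟨hs1, hs1, SimpleGraph.Reachable.refl _⟩, h⟩
  have key : ∀ q' : unitInterval,
      sahiE3 (prodBernoulli (Function.update w e q')) (openConn s a) (openConn s b) (openConn s c)
        = sahiE3 (prodBernoulli (Function.update w e q')) (openConnIn V₂ s a) (openConnIn V₂ s b) (openConnIn V₂ s c) := by
    intro q'
    exact sahiE3_congr_of_sure MeasurableSet.of_discrete (real_sureClosed (Function.update w e q'))
      (fun ω hω => far_iff q' ω hω ha) (fun ω hω => far_iff q' ω hω hb) (fun ω hω => far_iff q' ω hω hc)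
  -- the far events are determined by pairs inside `V₂`, which miss `e`
  set K : Set (Sym2 (Fin n)) := {z : Sym2 (Fin n) | ¬ z.IsDiag ∧ ∀ v ∈ z, v ∈ V₂} with hK
  have heK : e ∉ K := fun h => hx2 (h.2 x (by rw [he]; exact Sym2.mem_mk_right s x))
  have dA : ∀ t : Fin n, DeterminedBy (openConnIn V₂ s t : Set (BondConfig (Fin n))) K := fun t =>
    IncStarCutVertex.determinedBy_openConnIn_offDiag V₂ s t
  have mom : ∀ {A : Set (BondConfig (Fin n))}, DeterminedBy A K →
      (prodBernoulli (Function.update w e q)).real A = (prodBernoulli w).real A :=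
    fun hA => real_update_eq_of_determinedBy hA w heK q
  have hw : sahiE3 (prodBernoulli w) (openConn s a) (openConn s b) (openConn s c)
      = sahiE3 (prodBernoulli w) (openConnIn V₂ s a) (openConnIn V₂ s b) (openConnIn V₂ s c) := by
    have h := key (w e)
    rwa [Function.update_eq_self] at h
  rw [key q, hw, sahiE3_def, sahiE3_def, mom (((dA a).inter (dA b)).inter (dA c)), mom (dA a), mom (dA b), mom (dA c),
    mom ((dA b).inter (dA c)), mom ((dA a).inter (dA c)), mom ((dA a).inter (dA b))]

/-! ### Blob reparametrisation of a pair meeting a blob -/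

/-- **Blob reparametrisation.**  Let `B` be a set of vertices containing `x` but not `s, y, a, b, c`, with no positive pair from `B` to the
outside of `B ∪ {s, y}`, and let `e = s(x, t)` with `t ∈ {s, y}` (a root pair into the blob, or the blob's exit pair).  Then there are
`θ₀ ≤ θ₁` such that for every `q ∈ [0,1]`, `E₃(w[e↦q]) = E₃(W[s(s,y)↦r])` with `r = (1−q)θ₀ + qθ₁ ∈ [0,1]`, where `W` is `w` switched off on
the pairs meeting `B`.  (`θ_i` = the probability that the two-terminal network formed by the pairs meeting `B` and `s(s,y)` joins `s` to `y`
when `e` is closed / open; `SahiBlobReduction.sahiE3_incStar_blobReduce` + one-bond decomposition.) [this work] -/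
theorem incStar_blob_transfer (w : Sym2 (Fin n) → unitInterval) (B : Finset (Fin n)) {s x y t a b c : Fin n}
    (hsB : s ∉ B) (hyB : y ∉ B) (hsy : s ≠ y) (hxB : x ∈ B) (ht : t = s ∨ t = y)
    (hw : ∀ x' ∈ B, ∀ z, z ∉ B → z ≠ s → z ≠ y → w s(x', z) = 0)
    (ha : a ∉ B) (hb : b ∉ B) (hc : c ∉ B) :
    ∃ θ₀ θ₁ : ℝ, θ₀ ≤ θ₁ ∧ ∀ q : unitInterval, ∃ r : unitInterval,
      (r : ℝ) = (1 - (q : ℝ)) * θ₀ + (q : ℝ) * θ₁ ∧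
      sahiE3 (prodBernoulli (Function.update w s(x, t) q)) (openConn s a) (openConn s b) (openConn s c)
        = sahiE3 (prodBernoulli (Function.update (fun z => if (∃ x' ∈ B, x' ∈ z) then 0 else w z) s(s, y) r))
          (openConn s a) (openConn s b) (openConn s c) := by
  have htB : t ∉ B := by
    rcases ht with rfl | rfl
    · exact hsB
    · exact hyB
  -- the blob network: pairs meeting `B`, plus `s(s, y)`
  obtain ⟨N, hN⟩ : ∃ N : Sym2 (Fin n) → unitInterval,
      ∀ e', N e' = if (∃ x' ∈ B, x' ∈ e') ∨ e' = s(s, y) then w e' else 0 := ⟨_, fun _ => rfl⟩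
  have heB : ∃ x' ∈ B, x' ∈ s(x, t) := ⟨x, hxB, Sym2.mem_mk_left x t⟩
  refine ⟨(prodBernoulli (Function.update N s(x, t) 0)).real (openConn s y),
    (prodBernoulli (Function.update N s(x, t) 1)).real (openConn s y),
    tieLiftOne_real_zero_le_one N s(x, t) (isUpperSet_openConn s y), fun q => ?_⟩
  have hr0 : 0 ≤ (prodBernoulli (Function.update N s(x, t) q)).real (openConn s y) := measureReal_nonneg
  have hr1 : (prodBernoulli (Function.update N s(x, t) q)).real (openConn s y) ≤ 1 := measureReal_le_one
  refine ⟨⟨_, Set.mem_Icc.2 ⟨hr0, hr1⟩⟩, HullPort.real_update_affine N s(x, t) q (openConn s y), ?_⟩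
  -- the blob reduction for the weight `w[e↦q]`
  refine SahiBlobReduction.sahiE3_incStar_blobReduce (Function.update w s(x, t) q)
    (Function.update (fun z => if (∃ x' ∈ B, x' ∈ z) then 0 else w z) s(s, y) ⟨_, Set.mem_Icc.2 ⟨hr0, hr1⟩⟩) B hsB hyB hsy hsB
    ?_ ?_ ?_ ?_ ha hb hc
  · -- no positive pair leaves the blob except through the terminals
    intro x' hx' z hzB hzs hzy
    have hne : s(x', z) ≠ s(x, t) := by
      intro h
      rw [Sym2.eq_iff] at h
      rcases h with ⟨-, h2⟩ | ⟨h1, h2⟩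
      · rcases ht with ht | ht
        · exact hzs (h2.trans ht)
        · exact hzy (h2.trans ht)
      · exact hzB (h2 ▸ hxB)
    rw [Function.update_of_ne hne]
    exact hw x' hx' z hzB hzs hzy
  · -- the reduced weight vanishes on the pairs meeting `B`
    intro x' hx' z
    have hne : s(x', z) ≠ s(s, y) := by
      intro h
      rw [Sym2.eq_iff] at h
      rcases h with ⟨h1, -⟩ | ⟨h1, -⟩
      · exact hsB (h1 ▸ hx')
      · exact hyB (h1 ▸ hx')
    rw [Function.update_of_ne hne]
    exact if_pos ⟨x', hx', Sym2.mem_mk_left x' z⟩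
  · -- and agrees with `w[e↦q]` off the blob
    intro e' he'B he'f
    have hne : e' ≠ s(x, t) := by
      obtain ⟨x', hx', hx'e⟩ := heB
      exact fun h => he'B x' hx' (h ▸ hx'e)
    rw [Function.update_of_ne he'f, Function.update_of_ne hne]
    exact if_neg (by push Not; exact he'B)
  · -- the new weight of `s(s, y)` is the blob's two-terminal probability under `w[e↦q]`
    rw [Function.update_self]
    change (prodBernoulli (Function.update N s(x, t) q)).real (openConn s y) = _
    refine congrArg (fun μ : Measure (BondConfig (Fin n)) => μ.real (openConn s y)) (congrArg prodBernoulli ?_)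
    funext e'
    by_cases h' : e' = s(x, t)
    · subst h'
      rw [Function.update_self, Function.update_self, if_pos (Or.inl heB)]
    · rw [Function.update_of_ne h', Function.update_of_ne h', hN e']
      by_cases hc' : (∃ x' ∈ B, x' ∈ e') ∨ e' = s(s, y)
      · simp only [if_pos hc']
      · simp only [if_neg hc']

/-- **Blob reparametrisation of a root pair** `s(s, x)` into the blob (the case `t = s` of `incStar_blob_transfer`). [this work] -/
theorem incStar_rootPair_blob_transfer (w : Sym2 (Fin n) → unitInterval) (B : Finset (Fin n)) {s x y a b c : Fin n}
    (hsB : s ∉ B) (hyB : y ∉ B) (hsy : s ≠ y) (hxB : x ∈ B)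
    (hw : ∀ x' ∈ B, ∀ z, z ∉ B → z ≠ s → z ≠ y → w s(x', z) = 0)
    (ha : a ∉ B) (hb : b ∉ B) (hc : c ∉ B) :
    ∃ θ₀ θ₁ : ℝ, θ₀ ≤ θ₁ ∧ ∀ q : unitInterval, ∃ r : unitInterval,
      (r : ℝ) = (1 - (q : ℝ)) * θ₀ + (q : ℝ) * θ₁ ∧
      sahiE3 (prodBernoulli (Function.update w s(s, x) q)) (openConn s a) (openConn s b) (openConn s c)
        = sahiE3 (prodBernoulli (Function.update (fun z => if (∃ x' ∈ B, x' ∈ z) then 0 else w z) s(s, y) r))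
          (openConn s a) (openConn s b) (openConn s c) := by
  have h := incStar_blob_transfer w B hsB hyB hsy hxB (Or.inl rfl) hw ha hb hc
  rw [Sym2.eq_swap (a := x) (b := s)] at h
  exact h

end IncStar

end Summit.CriticalPhenomena.PercolationContinuityZ3.Theorems
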